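import Summits.ValiantsHypothesis.ValiantsHypothesis.Theorems.DivisionGapPerDivisionHardStubTorus
import Summits.ValiantsHypothesis.ValiantsHypothesis.Theorems.DivisionGapPerDivisionHardStubSparseRigidCount

/-!
# Crux `DivisionGap.PerDivisionHard` (stmt-ValiantsHypothesis-5065), line
`pair-descent-jss-endpoint` (v13) — stub `stub_torusSplit`: the torus normal form WITHIN a
row-split class

A ROW-SPLIT cofactor for a row set `A ⊆ [n]` is `h = Σ_{t < W} f_t · g_t` with every `f_t` in the
variables `x_(r,c)`, `r ∈ A`, and every `g_t` in the variables of the rows `r ∉ A`.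
`stub_torusSplit`: if such an `h` is nonzero, some nonzero TORUS-HOMOGENEOUS `h'`
(`IsTorusHomogeneous`: all monomials share the row-margin vector and the column-margin vector)
costs no more in either monotone complexity (`L(per_n · h') ≤ L(per_n · h)`, `L(h') ≤ L(h)`, the
tree's fan-in-two `complexity` over the semiring `ℝ≥0`) AND its monomials have at most `W` distinct
`A`-column contents `cc ↦ Σ_{r ∈ A} m (r, cc)`.

Proof.  (1) STRUCTURE (`topComponent_sum_mul`): over `ℝ≥0` the top-`w` component of a split sum
`Σ_t F_t · G_t` is again a split sum over the SAME index set — keep the summands whose weighted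
degree is that of the whole sum (the support of a positive sum is the union of the supports, so
the weighted degree of the sum is the maximum over the summands, and a summand of smaller weighted
degree has no coefficient at the top weight) and replace both factors by their top components
(`topComponent_mul`); supports only shrink (`support_topComponent_subset`), so the variable
constraints persist.  (2) The two initial-form steps of `stub_torus`
(`Theorems/DivisionGapPerDivisionHardStubTorus.lean`): the digit weights of `Prod.fst` and
`Prod.snd` in radix `deg + 1` make the margins constant on the top fibre
(`mapDomain_eq_of_mem_support_topComponent`), the permanent is weighted-homogeneous for both
(`isWeightedHomogeneous_perPoly_digitWeight`), so `top (per · h) = per · top h` and initial forms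
are free (`complexity_topComponent_le`).  (3) THE BOUND: for two monomials `a + b`, `a' + b'` of one
summand `F_t · G_t` of the final split sum `h'` (`a, a'` monomials of `F_t`, in the rows of `A`;
`b, b'` monomials of `G_t`, off the rows of `A`; `support_mul_eq`) the cross sum `a' + b` is a
monomial of `F_t · G_t` and hence of `h'` too (no cancellation), so torus homogeneity of `h'` gives
`colDegrees a = colDegrees a'`; and the `A`-column content of `a + b` is `colDegrees a`.  Hence the
`A`-column content is constant on the support of every summand, and there are `W` summands.
[folklore]
-/

noncomputable section

-- `Summit.ValiantsHypothesis.ValiantsHypothesis.…` is the tree's mandated single-conjunct layout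
-- (Sub = Summit), so the duplicated namespace component is intended.
set_option linter.dupNamespace false

namespace Summit.ValiantsHypothesis.ValiantsHypothesis.Theorems.DivisionGapPerDivisionHard

open MvPolynomial Literature.Computability.AlgebraicComplexity
open Literature.Barriers.ValiantsHypothesis
open Summit.ValiantsHypothesis.ValiantsHypothesis.Theorems.ZeroOneTransfer.Negative
open scoped NNReal Pointwise

variable {n : ℕ}

/-! ### Positive sums: supports and weighted degrees of the summands -/

/-- Over `ℝ≥0` (no cancellation) the support of a summand lies in the support of a finite sum.
[folklore] -/
theorem support_summand_subset {σ ι : Type*} (s : Finset ι) (F : ι → MvPolynomial σ ℝ≥0)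
    {t : ι} (ht : t ∈ s) : (F t).support ⊆ (∑ i ∈ s, F i).support := by
  intro m hm
  rw [mem_support_iff, coeff_sum]
  exact fun h0 => (mem_support_iff.mp hm) (Finset.sum_eq_zero_iff.mp h0 t ht)

/-- Over `ℝ≥0` the weighted degree of a summand is at most that of a finite sum. [folklore] -/
theorem weightedTotalDegree_summand_le {σ ι : Type*} (w : σ → ℕ) (s : Finset ι)
    (F : ι → MvPolynomial σ ℝ≥0) {t : ι} (ht : t ∈ s) :
    weightedTotalDegree w (F t) ≤ weightedTotalDegree w (∑ i ∈ s, F i) :=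
  Finset.sup_le fun _ hd => le_weightedTotalDegree w (support_summand_subset s F ht hd)

/-! ### Top components of split sums -/

/-- **The top component of a split sum `Σ_t F_t · G_t` over `ℝ≥0` is a split sum over the same
index set**: keep the summands whose weighted degree is that of the whole sum and replace both
factors by their top components (`topComponent_mul`); a summand of smaller weighted degree has
no coefficient at the top weight. [folklore] -/
theorem topComponent_sum_mul {σ ι : Type*} [DecidableEq σ] (w : σ → ℕ) (s : Finset ι)
    (F G : ι → MvPolynomial σ ℝ≥0) :
    topComponent w (∑ t ∈ s, F t * G t) =
      ∑ t ∈ s, (if F t * G t ≠ 0 ∧ weightedTotalDegree w (F t * G t) =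
          weightedTotalDegree w (∑ i ∈ s, F i * G i) then topComponent w (F t) else 0) *
        topComponent w (G t) := by
  set S := ∑ i ∈ s, F i * G i with hS
  refine MvPolynomial.ext _ _ fun d => ?_
  have key : ∀ t ∈ s,
      coeff d ((if F t * G t ≠ 0 ∧ weightedTotalDegree w (F t * G t) = weightedTotalDegree w S
          then topComponent w (F t) else 0) * topComponent w (G t)) =
        if Finsupp.weight w d = weightedTotalDegree w S then coeff d (F t * G t) else 0 := by
    intro t ht
    split_ifs with hc hd hd
    · rw [← topComponent_mul, coeff_topComponent, hc.2, if_pos hd]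
    · rw [← topComponent_mul, coeff_topComponent, hc.2, if_neg hd]
    · rw [zero_mul, coeff_zero]
      by_cases h0 : F t * G t = 0
      · rw [h0, coeff_zero]
      -- `wdeg (F t * G t) < wdeg S = weight d`, so `d` is no monomial of `F t * G t`
      have hlt : weightedTotalDegree w (F t * G t) < Finsupp.weight w d :=
        (lt_of_le_of_ne (weightedTotalDegree_summand_le w s (fun i => F i * G i) ht)
          fun h => hc ⟨h0, h⟩).trans_eq hd.symm
      symm
      by_contra hne
      exact (not_le.mpr hlt) (le_weightedTotalDegree w (mem_support_iff.mpr hne))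
    · rw [zero_mul, coeff_zero]
  rw [coeff_topComponent, coeff_sum, coeff_sum]
  split_ifs with hd
  · exact Finset.sum_congr rfl fun t ht => by rw [key t ht, if_pos hd]
  · symm
    exact Finset.sum_eq_zero fun t ht => by rw [key t ht, if_neg hd]

/-- Existential form of `topComponent_sum_mul` over `Fin W`: the top component of `Σ_t F_t · G_t`
is `Σ_t F'_t · G'_t` with `supp F'_t ⊆ supp F_t` and `supp G'_t ⊆ supp G_t` (supports of top
components only shrink, `support_topComponent_subset`). [folklore] -/
theorem exists_rowSplit_topComponent {σ : Type*} [DecidableEq σ] {W : ℕ} (w : σ → ℕ)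
    (F G : Fin W → MvPolynomial σ ℝ≥0) :
    ∃ F' G' : Fin W → MvPolynomial σ ℝ≥0, (∀ t, (F' t).support ⊆ (F t).support) ∧
      (∀ t, (G' t).support ⊆ (G t).support) ∧
      topComponent w (∑ t, F t * G t) = ∑ t, F' t * G' t := by
  refine ⟨fun t => if F t * G t ≠ 0 ∧ weightedTotalDegree w (F t * G t) =
      weightedTotalDegree w (∑ i, F i * G i) then topComponent w (F t) else 0,
    fun t => topComponent w (G t), fun t => ?_, fun t => support_topComponent_subset w (G t),
    topComponent_sum_mul w Finset.univ F G⟩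
  dsimp only
  split_ifs
  · exact support_topComponent_subset w (F t)
  · simp

/-! ### One degeneration step within a row-split class -/

/-- **One torus step within a row-split class.**  For a nonzero row-split sum `Σ_t F_t · G_t`
(`F_t` in the rows of `A`, `G_t` off the rows of `A`) and the digit weight of `f` (radix
`deg + 1`), the top component is again a row-split sum `Σ_t F'_t · G'_t` over the same index set,
nonzero, with support inside that of the sum, with constant `f`-margins, and it costs nothing:
`L(per · Σ F' G') ≤ L(per · Σ F G)` and `L(Σ F' G') ≤ L(Σ F G)` (as in
`exists_topComponent_const_margins`). [folklore] -/
theorem exists_topComponent_const_margins_rowSplit (f : Fin n × Fin n → Fin n)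
    (hf : ∀ (B : ℕ) (π : Equiv.Perm (Fin n)),
      ∑ i : Fin n, B ^ ((f (π i, i) : Fin n) : ℕ) = ∑ a : Fin n, B ^ ((a : Fin n) : ℕ))
    {W : ℕ} (A : Finset (Fin n)) {F G : Fin W → MvPolynomial (Fin n × Fin n) ℝ≥0}
    (hp : ∑ t, F t * G t ≠ 0) (hF : ∀ t, ∀ mm ∈ (F t).support, ∀ e ∈ mm.support, e.1 ∈ A)
    (hG : ∀ t, ∀ mm ∈ (G t).support, ∀ e ∈ mm.support, e.1 ∉ A) :
    ∃ F' G' : Fin W → MvPolynomial (Fin n × Fin n) ℝ≥0,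
      (∀ t, ∀ mm ∈ (F' t).support, ∀ e ∈ mm.support, e.1 ∈ A) ∧
      (∀ t, ∀ mm ∈ (G' t).support, ∀ e ∈ mm.support, e.1 ∉ A) ∧
      ∑ t, F' t * G' t ≠ 0 ∧ (∑ t, F' t * G' t).support ⊆ (∑ t, F t * G t).support ∧
      (∀ m ∈ (∑ t, F' t * G' t).support, ∀ m' ∈ (∑ t, F' t * G' t).support,
        Finsupp.mapDomain f m = Finsupp.mapDomain f m') ∧
      complexity (perPoly (Fin n) ℝ≥0 * ∑ t, F' t * G' t) ≤
        complexity (perPoly (Fin n) ℝ≥0 * ∑ t, F t * G t) ∧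
      complexity (∑ t, F' t * G' t) ≤ complexity (∑ t, F t * G t) := by
  obtain ⟨F', G', hF', hG', heq⟩ := exists_rowSplit_topComponent
    (fun v => ((∑ t, F t * G t).totalDegree + 1) ^ ((f v : Fin n) : ℕ)) F G
  refine ⟨F', G', fun t mm hmm => hF t mm (hF' t hmm), fun t mm hmm => hG t mm (hG' t hmm), ?_⟩
  rw [← heq]
  set p := ∑ t, F t * G t
  set Wt : Fin n × Fin n → ℕ := fun v => (p.totalDegree + 1) ^ ((f v : Fin n) : ℕ)
  refine ⟨topComponent_ne_zero Wt hp, support_topComponent_subset Wt p,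
    fun m hm m' hm' => mapDomain_eq_of_mem_support_topComponent f p hm hm', ?_,
    complexity_topComponent_le Wt p⟩
  have := complexity_topComponent_le Wt (perPoly (Fin n) ℝ≥0 * p)
  rwa [topComponent_mul, topComponent_eq_self_of_isWeightedHomogeneous Wt
    (isWeightedHomogeneous_perPoly_digitWeight f _ (hf _))] at this

/-! ### `A`-column contents of a torus-homogeneous row-split sum -/

/-- For a monomial `a` in the rows of `A` plus a monomial `b` off the rows of `A`, the `A`-column
content of `a + b` is the column-margin vector of `a`. [folklore] -/
theorem colContent_add_of_rowSplit (A : Finset (Fin n)) {a b : (Fin n × Fin n) →₀ ℕ}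
    (ha : ∀ e ∈ a.support, e.1 ∈ A) (hb : ∀ e ∈ b.support, e.1 ∉ A) (cc : Fin n) :
    ∑ r ∈ A, (a + b) (r, cc) = Finsupp.mapDomain Prod.snd a cc := by
  rw [colDegrees_apply]
  have h1 : ∑ r ∈ A, a (r, cc) = ∑ r, a (r, cc) :=
    Finset.sum_subset (Finset.subset_univ A) fun r _ hr =>
      Finsupp.notMem_support_iff.mp fun h => hr (ha _ h)
  rw [← h1]
  refine Finset.sum_congr rfl fun r hr => ?_
  rw [Finsupp.add_apply, Finsupp.notMem_support_iff.mp fun h => hb _ h hr, add_zero]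

/-- **The `A`-column content is constant on the support of a row-split product `P · Q` inside a
polynomial `H` with constant column margins** (`P` in the rows of `A`, `Q` off the rows of `A`):
for monomials `a + b`, `a' + b'` of `P · Q` the cross sum `a' + b` is a monomial of `P · Q ⊆ H` too
(`support_mul_eq`, no cancellation over `ℝ≥0`), so `colDegrees a = colDegrees a'`
(`Finsupp.mapDomain_add`, cancellation in `ℕ^n`), and the `A`-column content of `a + b` is
`colDegrees a` (`colContent_add_of_rowSplit`). [folklore] -/
theorem colContent_const_on_summand (A : Finset (Fin n))
    {P Q H : MvPolynomial (Fin n × Fin n) ℝ≥0} (hPQ : (P * Q).support ⊆ H.support)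
    (hH : ∀ m ∈ H.support, ∀ m' ∈ H.support,
      Finsupp.mapDomain Prod.snd m = Finsupp.mapDomain Prod.snd m')
    (hP : ∀ mm ∈ P.support, ∀ e ∈ mm.support, e.1 ∈ A)
    (hQ : ∀ mm ∈ Q.support, ∀ e ∈ mm.support, e.1 ∉ A)
    {m m' : (Fin n × Fin n) →₀ ℕ} (hm : m ∈ (P * Q).support) (hm' : m' ∈ (P * Q).support)
    (cc : Fin n) : ∑ r ∈ A, m (r, cc) = ∑ r ∈ A, m' (r, cc) := by
  rw [JerrumSnir.support_mul_eq] at hm hm' hPQ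
  obtain ⟨a, ha, b, hb, rfl⟩ := Finset.mem_add.mp hm
  obtain ⟨a', ha', b', hb', rfl⟩ := Finset.mem_add.mp hm'
  have h1 := hH _ (hPQ (Finset.add_mem_add ha hb)) _ (hPQ (Finset.add_mem_add ha' hb))
  rw [Finsupp.mapDomain_add, Finsupp.mapDomain_add, add_left_inj] at h1
  rw [colContent_add_of_rowSplit A (hP a ha) (hQ b hb) cc,
    colContent_add_of_rowSplit A (hP a' ha') (hQ b' hb') cc, h1]

/-- **At most `W` distinct `A`-column contents.**  If `Σ_{t < W} F_t · G_t` is row-split for `A`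
and has constant column margins, its monomials have at most `W` distinct `A`-column contents:
every monomial lies in the support of some summand (`MvPolynomial.support_sum`), on which the
`A`-column content is constant (`colContent_const_on_summand`). [folklore] -/
theorem card_image_colContent_le_of_rowSplit {W : ℕ} (A : Finset (Fin n))
    {F G : Fin W → MvPolynomial (Fin n × Fin n) ℝ≥0}
    (hF : ∀ t, ∀ mm ∈ (F t).support, ∀ e ∈ mm.support, e.1 ∈ A)
    (hG : ∀ t, ∀ mm ∈ (G t).support, ∀ e ∈ mm.support, e.1 ∉ A)
    (hcol : ∀ m ∈ (∑ t, F t * G t).support, ∀ m' ∈ (∑ t, F t * G t).support,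
      Finsupp.mapDomain Prod.snd m = Finsupp.mapDomain Prod.snd m') :
    ((∑ t, F t * G t).support.image
        fun (mm : (Fin n × Fin n) →₀ ℕ) (cc : Fin n) => ∑ r ∈ A, mm (r, cc)).card ≤ W := by
  classical
  -- the `A`-column content is constant on the support of each summand
  have key : ∀ t, ∃ v : Fin n → ℕ, ∀ m ∈ (F t * G t).support,
      (fun cc => ∑ r ∈ A, m (r, cc)) = v := by
    intro t
    rcases (F t * G t).support.eq_empty_or_nonempty with he | ⟨m₀, hm₀⟩
    · exact ⟨0, fun m hm => by simp [he] at hm⟩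
    · exact ⟨fun cc => ∑ r ∈ A, m₀ (r, cc), fun m hm => funext fun cc =>
        colContent_const_on_summand A
          (support_summand_subset Finset.univ (fun i => F i * G i) (Finset.mem_univ t))
          hcol (hF t) (hG t) hm hm₀ cc⟩
  choose φ hφ using key
  calc _ ≤ (Finset.univ.image φ).card := by
        refine Finset.card_le_card fun v hv => ?_
        obtain ⟨m, hm, rfl⟩ := Finset.mem_image.mp hv
        obtain ⟨t, -, hmt⟩ := Finset.mem_biUnion.mp (MvPolynomial.support_sum hm)
        exact Finset.mem_image.mpr ⟨t, Finset.mem_univ _, (hφ t m hmt).symm⟩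
    _ ≤ (Finset.univ : Finset (Fin W)).card := Finset.card_image_le
    _ = W := Finset.card_fin W

/-! ### The stub -/

/-- **`stub_torusSplit` (v13 of line `pair-descent-jss-endpoint` for `PerDivisionHard`).  The
torus normal form WITHIN a row-split class.**  If `h = Σ_{t < W} f_t · g_t ≠ 0` with every `f_t`
in the variables of the rows of `A` and every `g_t` in the variables of the other rows, then some
nonzero TORUS-HOMOGENEOUS `h'` whose monomials have at most `W` distinct `A`-column contents
`cc ↦ Σ_{r ∈ A} m (r, cc)` costs no more in either monotone complexity:
`L(per_n · h') ≤ L(per_n · h)` and `L(h') ≤ L(h)`.  Two torus steps within the class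
(`exists_topComponent_const_margins_rowSplit` for `Prod.fst`, then `Prod.snd`; supports only
shrink, so the row margins stay constant), then `card_image_colContent_le_of_rowSplit`.
[folklore] -/
theorem stub_torusSplit :
    ∀ (n W : ℕ) (A : Finset (Fin n)) (f g : Fin W → MvPolynomial (Fin n × Fin n) ℝ≥0),
      ∑ t, f t * g t ≠ 0 →
      (∀ t, ∀ mm ∈ (f t).support, ∀ e ∈ mm.support, e.1 ∈ A) →
      (∀ t, ∀ mm ∈ (g t).support, ∀ e ∈ mm.support, e.1 ∉ A) →
      ∃ h' : MvPolynomial (Fin n × Fin n) ℝ≥0, h' ≠ 0 ∧ IsTorusHomogeneous h' ∧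
        (h'.support.image
            fun (mm : (Fin n × Fin n) →₀ ℕ) (cc : Fin n) => ∑ r ∈ A, mm (r, cc)).card ≤ W ∧
        complexity (perPoly (Fin n) ℝ≥0 * h') ≤
          complexity (perPoly (Fin n) ℝ≥0 * ∑ t, f t * g t) ∧
        complexity h' ≤ complexity (∑ t, f t * g t) := by
  intro n W A f g hh hf hg
  -- row step: `per` is row-homogeneous since `i ↦ π i` is a bijection
  obtain ⟨f₁, g₁, hf₁, hg₁, hh₁, -, hrow, hle₁, hle₁'⟩ :=
    exists_topComponent_const_margins_rowSplit Prod.fst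
      (fun B π => Equiv.sum_comp π (fun a : Fin n => B ^ ((a : Fin n) : ℕ))) A hh hf hg
  -- column step: `per` is column-homogeneous trivially
  obtain ⟨f₂, g₂, hf₂, hg₂, hh₂, hsub, hcol, hle₂, hle₂'⟩ :=
    exists_topComponent_const_margins_rowSplit Prod.snd (fun B π => rfl) A hh₁ hf₁ hg₁
  obtain ⟨d₀, hd₀⟩ := exists_coeff_ne_zero hh₂
  have hd₀s : d₀ ∈ (∑ t, f₂ t * g₂ t).support := mem_support_iff.mpr hd₀
  exact ⟨∑ t, f₂ t * g₂ t, hh₂,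
    ⟨rowDegrees d₀, Finsupp.mapDomain Prod.snd d₀, fun m hm =>
      ⟨hrow m (hsub hm) d₀ (hsub hd₀s), hcol m hm d₀ hd₀s⟩⟩,
    card_image_colContent_le_of_rowSplit A hf₂ hg₂ hcol, hle₂.trans hle₁, hle₂'.trans hle₁'⟩

end Summit.ValiantsHypothesis.ValiantsHypothesis.Theorems.DivisionGapPerDivisionHard

end
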